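import Literature.NumberTheory.EllipticCurves.ModularSymbolsMeasureApproximations
import Literature.NumberTheory.EllipticCurves.PAdicMeasureLatticeComplete
import HarnessLib

/-!
# `Symb_{Γ₀(N)}(𝔻⁰_k) = lim_n Symb_{Γ₀(N)}(𝔻⁰_k/K_n)` and Hida's ordinary projector on measure-valued symbols

For `p ∣ N` and the integral coefficient system `𝔻⁰_k` (`distCoeffInt`) with its finite approximations
`𝔻⁰_k/K_n` (`approxCoeff`, `ModularSymbolsMeasureApproximations`) we prove that the reduction maps
`π_n : Symb(𝔻⁰) → Symb(𝔻⁰/K_n)` (`symbApprox`) present `Symb(𝔻⁰)` as the inverse limit of the finite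
levels:

* compatibility `t_{n,n'} ∘ π_{n'} = π_n` (`symbTrans_comp_symbApprox`) and **joint injectivity**
  (`symb_eq_of_forall_symbApprox_eq`, from `⋂ K_n = 0`);
* **gluing** (`glue`, `symbApprox_glue`): every compatible family `(Φ_n ∈ Symb(𝔻⁰/K_n))_n` comes from a
  unique `Φ ∈ Symb(𝔻⁰)` — the values are the `K`-adic limits of representatives
  (`PAdicMeasureLatticeComplete.limitFn`), additivity and `Γ₀(N)`-invariance hold modulo every `K_n`,
  hence exactly.

Consequently **Hida's ordinary projector `e` on `Symb_{Γ₀(N)}(𝔻⁰_k)`** is defined by gluing the finite-level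
projectors `ordApprox n` (compatible by `symbTrans_ordApprox`): `ordInt` is a `ℤ_p`-linear idempotent
commuting with `U_p` and reducing to `ordApprox n` at every level (`symbApprox_ordInt`, `ordInt_idem`,
`ordInt_comm_hecke`) — the projector `e = lim U_p^{m!}` of Greenberg–Stevens 1993, §1 on measure-valued
modular symbols, without Banach-space theory.

Brick B2m-b of the bottom-up plan recorded with the named fact
`greenbergStevens_kitagawa_twoVariable_interpolation_allBranches`.  Everything is proved; no named facts.

## References

* R. Greenberg, G. Stevens, Invent. Math. 111 (1993), §1. [GreenbergStevens1993]
* H. Hida, LMS Student Texts 26 (1993), §7.2. [Hida1993LFE]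
-/

noncomputable section

open scoped MatrixGroups
open Matrix CongruenceSubgroup

namespace Literature.NumberTheory.EllipticCurves

open ModularForms ModularForms.HidaCohomology

variable {p : ℕ} [Fact p.Prime]

/-! ### Reduction of values and the vanishing criterion -/

section Reduction

/-- An integral measure vanishing modulo every `K_n` is zero. [folklore] -/
theorem DInt.eq_zero_of_forall_mk_eq_zero (μ : DInt p)
    (h : ∀ n : ℕ, (Submodule.Quotient.mk μ : DInt p ⧸ congrSubInt p n) = 0) : μ = 0 := by
  refine Subtype.ext ((ProfiniteTower.padicInt p).eq_zero_of_forall_mem_congrSub fun n => ?_)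
  exact (mem_congrSubInt_iff (p := p)).mp ((Submodule.Quotient.mk_eq_zero _).mp (h n))

/-- Two integral measures congruent modulo every `K_n` are equal. [folklore] -/
theorem DInt.eq_of_forall_mk_eq (μ ν : DInt p)
    (h : ∀ n : ℕ, (Submodule.Quotient.mk μ : DInt p ⧸ congrSubInt p n) = Submodule.Quotient.mk ν) : μ = ν := by
  rw [← sub_eq_zero]
  refine DInt.eq_zero_of_forall_mk_eq_zero _ fun n => ?_
  rw [Submodule.Quotient.mk_sub, h n, sub_self]

/-- The value of `π_n Φ` at `(x, y)` is the class of `Φ(x, y)`. [folklore] -/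
theorem symbApprox_val (k N : ℕ) (hpN : p ∣ N) (n : ℕ) (Φ : (distCoeffInt p k N hpN).Symb (Gamma0 N)) (x y : P1Q) :
    (symbApprox k N hpN n Φ).1 x y = Submodule.Quotient.mk (Φ.1 x y) := rfl

/-- **Compatibility of the reductions**: `t_{n,n'} ∘ π_{n'} = π_n`. [folklore] -/
theorem symbTrans_comp_symbApprox (k N : ℕ) (hpN : p ∣ N) {n n' : ℕ} (h : n ≤ n') :
    (symbTrans k N hpN h).comp (symbApprox k N hpN n') = symbApprox k N hpN n := by
  refine LinearMap.ext fun Φ => Subtype.ext (funext fun x => funext fun y => ?_)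
  rfl

/-- **Joint injectivity of the reductions** (`⋂ K_n = 0`). [folklore] -/
theorem symb_eq_of_forall_symbApprox_eq (k N : ℕ) (hpN : p ∣ N) {Φ Ψ : (distCoeffInt p k N hpN).Symb (Gamma0 N)}
    (h : ∀ n : ℕ, symbApprox k N hpN n Φ = symbApprox k N hpN n Ψ) : Φ = Ψ := by
  refine Subtype.ext (funext fun x => funext fun y => DInt.eq_of_forall_mk_eq _ _ fun n => ?_)
  have := congrArg (fun Θ : (approxCoeff p k N hpN n).Symb (Gamma0 N) => Θ.1 x y) (h n)
  exact this

end Reduction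

/-! ### Gluing compatible families -/

section Glue

variable {k N : ℕ} {hpN : p ∣ N}

/-- Representatives of the values of a family of finite-level symbols. [folklore] -/
def reps (Φs : (n : ℕ) → (approxCoeff p k N hpN n).Symb (Gamma0 N)) (n : ℕ) (x y : P1Q) : DInt p :=
  ((Φs n).1 x y).out

/-- The representatives represent. [folklore] -/
theorem mk_reps (Φs : (n : ℕ) → (approxCoeff p k N hpN n).Symb (Gamma0 N)) (n : ℕ) (x y : P1Q) :
    (Submodule.Quotient.mk (reps Φs n x y) : DInt p ⧸ congrSubInt p n) = (Φs n).1 x y :=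
  Submodule.Quotient.mk_out _

/-- For a compatible family the representatives are compatible modulo the `K_n`. [folklore] -/
theorem reps_compatible (Φs : (n : ℕ) → (approxCoeff p k N hpN n).Symb (Gamma0 N))
    (hcompat : ∀ (n n' : ℕ) (h : n ≤ n'), symbTrans k N hpN h (Φs n') = Φs n) (x y : P1Q) :
    ∀ n n' : ℕ, n ≤ n' → (reps Φs n' x y).1 - (reps Φs n x y).1 ∈ (ProfiniteTower.padicInt p).congrSub p n := by
  intro n n' h
  have hval := congrArg (fun Θ : (approxCoeff p k N hpN n).Symb (Gamma0 N) => Θ.1 x y) (hcompat n n' h)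
  -- `t (Φs n') (x,y) = class of reps n'` in `𝔻⁰/K_n`
  have h1 : (symbTrans k N hpN h (Φs n')).1 x y = Submodule.Quotient.mk (reps Φs n' x y) := by
    have e1 : (symbTrans k N hpN h (Φs n')).1 x y = (transHom k N hpN h).toLinearMap ((Φs n').1 x y) := rfl
    rw [e1, ← mk_reps Φs n' x y]
    rfl
  have h2 : (Submodule.Quotient.mk (reps Φs n' x y) : DInt p ⧸ congrSubInt p n) = Submodule.Quotient.mk (reps Φs n x y) := by
    rw [← h1, mk_reps]; exact hval
  exact (mem_congrSubInt_iff (p := p)).mp ((Submodule.Quotient.eq _).mp h2)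

/-- **The glued values**: `K`-adic limits of the representatives. [folklore] -/
def glueVal (Φs : (n : ℕ) → (approxCoeff p k N hpN n).Symb (Gamma0 N))
    (hcompat : ∀ (n n' : ℕ) (h : n ≤ n'), symbTrans k N hpN h (Φs n') = Φs n) (x y : P1Q) : DInt p :=
  ⟨(ProfiniteTower.padicInt p).limitFn fun n => (reps Φs n x y).1,
    (ProfiniteTower.padicInt p).limitFn_mem (fun n => (reps Φs n x y).2) (reps_compatible Φs hcompat x y)⟩

/-- The glued value reduces to the given classes. [folklore] -/
theorem mk_glueVal (Φs : (n : ℕ) → (approxCoeff p k N hpN n).Symb (Gamma0 N))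
    (hcompat : ∀ (n n' : ℕ) (h : n ≤ n'), symbTrans k N hpN h (Φs n') = Φs n) (x y : P1Q) (n : ℕ) :
    (Submodule.Quotient.mk (glueVal Φs hcompat x y) : DInt p ⧸ congrSubInt p n) = (Φs n).1 x y := by
  rw [← mk_reps Φs n x y]
  refine (Submodule.Quotient.eq _).mpr ((mem_congrSubInt_iff (p := p)).mpr ?_)
  exact (ProfiniteTower.padicInt p).limitFn_sub_mem_congrSub (fun n => (reps Φs n x y).2) (reps_compatible Φs hcompat x y) n

/-- **The glued family is a `Γ₀(N)`-invariant modular symbol** (additivity and invariance hold modulo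
every `K_n`). [cite: GreenbergStevens1993, §1] -/
theorem glueVal_mem_Symb (Φs : (n : ℕ) → (approxCoeff p k N hpN n).Symb (Gamma0 N))
    (hcompat : ∀ (n n' : ℕ) (h : n ≤ n'), symbTrans k N hpN h (Φs n') = Φs n) :
    glueVal Φs hcompat ∈ (distCoeffInt p k N hpN).Symb (Gamma0 N) := by
  refine ⟨(mem_modSym_iff (R := ℤ_[p])).mpr fun x y z => ?_, fun γ hγ => ?_⟩
  · -- additivity
    rw [← sub_eq_zero]
    refine DInt.eq_zero_of_forall_mk_eq_zero _ fun n => ?_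
    rw [Submodule.Quotient.mk_sub, Submodule.Quotient.mk_add, mk_glueVal, mk_glueVal, mk_glueVal,
      (mem_modSym_iff (R := ℤ_[p])).mp (Φs n).2.1 x y z, sub_self]
  · -- invariance under `γ ∈ Γ₀(N)`
    funext x y
    refine DInt.eq_of_forall_mk_eq _ _ fun n => ?_
    have hγS : (γ : Matrix (Fin 2) (Fin 2) ℤ) ∈ sigma0Set N := coe_mem_sigma0Set' γ hγ
    -- reduce the slash through the projection morphism
    have hred : (Submodule.Quotient.mk ((distCoeffInt p k N hpN).slash (γ : Matrix (Fin 2) (Fin 2) ℤ) (glueVal Φs hcompat) x y) :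
        DInt p ⧸ congrSubInt p n) =
        (approxCoeff p k N hpN n).slash (γ : Matrix (Fin 2) (Fin 2) ℤ) ((approxHom k N hpN n).mapFun (glueVal Φs hcompat)) x y := by
      rw [← (approxHom k N hpN n).mapFun_slash hγS]; rfl
    have hfun : (approxHom k N hpN n).mapFun (glueVal Φs hcompat) = (Φs n).1 := by
      funext x' y'
      exact mk_glueVal Φs hcompat x' y' n
    rw [hred, hfun, (Φs n).2.2 γ hγ, mk_glueVal]

/-- **Gluing**: the symbol of `Symb(𝔻⁰)` attached to a compatible family. [cite: GreenbergStevens1993, §1] -/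
def glue (Φs : (n : ℕ) → (approxCoeff p k N hpN n).Symb (Gamma0 N))
    (hcompat : ∀ (n n' : ℕ) (h : n ≤ n'), symbTrans k N hpN h (Φs n') = Φs n) :
    (distCoeffInt p k N hpN).Symb (Gamma0 N) :=
  ⟨glueVal Φs hcompat, glueVal_mem_Symb Φs hcompat⟩

/-- **The glued symbol reduces to the given family.** [folklore] -/
theorem symbApprox_glue (Φs : (n : ℕ) → (approxCoeff p k N hpN n).Symb (Gamma0 N))
    (hcompat : ∀ (n n' : ℕ) (h : n ≤ n'), symbTrans k N hpN h (Φs n') = Φs n) (n : ℕ) :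
    symbApprox k N hpN n (glue Φs hcompat) = Φs n :=
  Subtype.ext (funext fun x => funext fun y => mk_glueVal Φs hcompat x y n)

/-- Uniqueness of the gluing. [folklore] -/
theorem glue_unique (Φs : (n : ℕ) → (approxCoeff p k N hpN n).Symb (Gamma0 N))
    (hcompat : ∀ (n n' : ℕ) (h : n ≤ n'), symbTrans k N hpN h (Φs n') = Φs n)
    {Φ : (distCoeffInt p k N hpN).Symb (Gamma0 N)} (hΦ : ∀ n, symbApprox k N hpN n Φ = Φs n) :
    Φ = glue Φs hcompat :=
  symb_eq_of_forall_symbApprox_eq k N hpN fun n => by rw [hΦ n, symbApprox_glue]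

end Glue

/-! ### The ordinary projector on `Symb(𝔻⁰_k)` -/

section Ord

variable [NeZero p] (k N : ℕ) [NeZero N] (hpN : p ∣ N)

/-- The family `(e_n (π_n Φ))_n` is compatible. [folklore] -/
theorem ordApprox_symbApprox_compatible (Φ : (distCoeffInt p k N hpN).Symb (Gamma0 N)) :
    ∀ (n n' : ℕ) (h : n ≤ n'), symbTrans k N hpN h (ordApprox k N hpN n' (symbApprox k N hpN n' Φ)) =
      ordApprox k N hpN n (symbApprox k N hpN n Φ) := by
  intro n n' h
  have h1 := LinearMap.congr_fun (symbTrans_ordApprox k N hpN h) (symbApprox k N hpN n' Φ)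
  have h2 := LinearMap.congr_fun (symbTrans_comp_symbApprox k N hpN h) Φ
  rw [LinearMap.comp_apply] at h1 h2
  rw [h1, LinearMap.comp_apply, h2]

/-- The glued ordinary projection of a symbol. [folklore] -/
def ordIntFun (Φ : (distCoeffInt p k N hpN).Symb (Gamma0 N)) : (distCoeffInt p k N hpN).Symb (Gamma0 N) :=
  glue (fun n => ordApprox k N hpN n (symbApprox k N hpN n Φ)) (ordApprox_symbApprox_compatible k N hpN Φ)

/-- **`π_n (e Φ) = e_n (π_n Φ)`.** [folklore] -/
theorem symbApprox_ordIntFun (Φ : (distCoeffInt p k N hpN).Symb (Gamma0 N)) (n : ℕ) :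
    symbApprox k N hpN n (ordIntFun k N hpN Φ) = ordApprox k N hpN n (symbApprox k N hpN n Φ) :=
  symbApprox_glue _ _ n

/-- **Hida's ordinary projector `e` on `Symb_{Γ₀(N)}(𝔻⁰_k)`** (`p ∣ N`), glued from the finite levels.
[cite: GreenbergStevens1993, §1] -/
def ordInt : Module.End ℤ_[p] ((distCoeffInt p k N hpN).Symb (Gamma0 N)) where
  toFun := ordIntFun k N hpN
  map_add' Φ Ψ := symb_eq_of_forall_symbApprox_eq k N hpN fun n => by
    rw [symbApprox_ordIntFun, map_add, map_add, map_add, symbApprox_ordIntFun, symbApprox_ordIntFun]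
  map_smul' c Φ := symb_eq_of_forall_symbApprox_eq k N hpN fun n => by
    rw [symbApprox_ordIntFun, map_smul, map_smul, RingHom.id_apply, map_smul, symbApprox_ordIntFun]

/-- **`e` reduces to `e_n` at every finite level.** [folklore] -/
theorem symbApprox_ordInt (Φ : (distCoeffInt p k N hpN).Symb (Gamma0 N)) (n : ℕ) :
    symbApprox k N hpN n (ordInt k N hpN Φ) = ordApprox k N hpN n (symbApprox k N hpN n Φ) :=
  symbApprox_ordIntFun k N hpN Φ n

/-- **`e` is idempotent.** [cite: Hida1993LFE, §7.2] -/
theorem ordInt_idem : (ordInt k N hpN).comp (ordInt k N hpN) = ordInt k N hpN := by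
  refine LinearMap.ext fun Φ => symb_eq_of_forall_symbApprox_eq k N hpN fun n => ?_
  rw [LinearMap.comp_apply, symbApprox_ordInt, symbApprox_ordInt]
  have h := LinearMap.congr_fun (ordApprox_idem_comm k N hpN n).1 (symbApprox k N hpN n Φ)
  rwa [LinearMap.comp_apply] at h

/-- **`e` commutes with `U_p`.** [cite: Hida1993LFE, §7.2] -/
theorem ordInt_comm_hecke : (ordInt k N hpN).comp (heckeInt k N hpN) = (heckeInt k N hpN).comp (ordInt k N hpN) := by
  refine LinearMap.ext fun Φ => symb_eq_of_forall_symbApprox_eq k N hpN fun n => ?_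
  have hπU := LinearMap.congr_fun (symbApprox_hecke k N hpN n)
  simp only [LinearMap.comp_apply] at hπU ⊢
  rw [symbApprox_ordInt, hπU, hπU, symbApprox_ordInt]
  have h := LinearMap.congr_fun (ordApprox_idem_comm k N hpN n).2 (symbApprox k N hpN n Φ)
  simpa only [LinearMap.comp_apply] using h

end Ord

end Literature.NumberTheory.EllipticCurves

end
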